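import Summits.SmoothPoincare4.SmoothPoincare4.Theorems.EntropyRungConicalGapReduction
import Summits.SmoothPoincare4.SmoothPoincare4.Theorems.EntropyRungConicalGapAvrSublevelLimit
import HarnessLib

/-!
# Crux `EntropyRung.ConicalGap` (stmt-SmoothPoincare4-16589), line `Sketch`: the thin-cone condition in classical form

`EntropyRungConicalGapReduction.lean` proved, on every complete connected normalised 4-d gradient shrinker,
`∫ e^{-f} dV = 16π² a + ∫ R k(f) dV` with `a = lim_T (16π²T²)⁻¹ ∫ e^{-f/T} dV` (`helper_densityTransform`),
`16π² a ≤ ∫ e^{-f} dV` (`helper_avr_le_density`) and `ConicalGap → 16π² a ≤ 32π²√π e^{-3/2}`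
(`helper_thinCone_of_conicalGap`); `EntropyRungConicalGapAvrSublevelLimit.lean` identified the regularised `a` with
the **sublevel asymptotic volume ratio** `A = lim_{t → ∞} Vol{f < t} / (8π² t²)` whenever that limit exists
(`helper_avr_eq_sublevelLimit`; Wang–Wang 2023 (2.6): on a shrinker `{f < t} ≈ B(2√t)` and `ω₄ (2√t)⁴ = 8π² t²`, so
`A = AVR(g)`; on the asymptotically conical class `A = Vol(N, h)/(2π²)` for the cone link `(N, h)`). This file
combines the two:

* `helper_sublevelAvr_le_density` — **`AVR ≤ Θ` in sublevel form** (Wang–Wang 2023 Thm 1.1, integrated version):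
  if `Vol{f < t}/(8π²t²) → A` then `16π² A ≤ ∫ e^{-f} dV`, on every complete connected normalised 4-d shrinker;
* `helper_sublevelAvr_le_of_conicalGap` — **"shrinker cones are thin"** (card `avr-window`, the necessary condition
  and cheapest falsifier of the crux): `ConicalGap` forces `A ≤ 2√π e^{-3/2} = Θ(S³×ℝ) ≈ 0.791` for every member of
  the crux class whose sublevel volume ratio converges — i.e. a complete non-flat 4-d shrinker with `R → 0`
  asymptotic to a cone whose link has `Vol(N, h) > 2π² · 2√π e^{-3/2} ≈ 15.61` refutes the crux.

Everything here is proved; no definition and no named fact is introduced.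
-/

noncomputable section

-- `Summit.SmoothPoincare4.SmoothPoincare4.…` (summit = problem) trips `dupNamespace` on every decl.
set_option linter.dupNamespace false

open scoped Manifold ContDiff ENNReal NNReal Topology
open MeasureTheory Set Filter
open Literature.Geometry.Lorentzian Literature.Geometry.Riemannian

namespace Summit.SmoothPoincare4.SmoothPoincare4.Theorems.ConicalGapSketch

/-- **`AVR ≤ Θ` in sublevel form** (Wang–Wang 2023 Thm 1.1, integrated): on a complete connected normalised 4-d
gradient shrinker, if `Vol{f < t}/(8π² t²) → A` as `t → ∞` then `16π² A ≤ ∫ e^{-f} dV` — by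
`helper_avr_eq_sublevelLimit` the regularised ratio of `helper_densityTransform` equals `A`, and
`helper_avr_le_density`. -/
theorem helper_sublevelAvr_le_density : ∀ (M : Type) [TopologicalSpace M] [T2Space M] [SecondCountableTopology M] [ChartedSpace (EuclideanSpace ℝ (Fin 4)) M] [IsManifold (𝓡 4) ∞ M] [ConnectedSpace M] [T3Space M] [MeasurableSpace M] [BorelSpace M] (g : Literature.Geometry.Lorentzian.PseudoRiemannianMetric (𝓡 4) ∞ (EuclideanSpace ℝ (Fin 4)) (TangentSpace (𝓡 4) : M → Type _)) [g.HasLeviCivita] (f : M → ℝ) (hg : g.IsRiemannian), (∀ (x : M) (r : NNReal), IsCompact {y : M | g.edist hg x y ≤ r}) → ContMDiff (𝓡 4) 𝓘(ℝ, ℝ) ∞ f → (∀ (x : M) (X Y : TangentSpace (𝓡 4) x), g.ricci x X Y + g.hessian f x X Y = (1 / 2 : ℝ) * g.val x X Y) → (∀ x : M, g.scalarCurvature x + g.gradSq f x = f x) → ∀ A : ℝ, Filter.Tendsto (fun t : ℝ ↦ ((Literature.Geometry.Lorentzian.riemannianMeasure (g.toContMDiffRiemannianMetric hg)) {x | f x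 < t}).toReal / (8 * Real.pi ^ 2 * t ^ 2)) Filter.atTop (nhds A) → 16 * Real.pi ^ 2 * A ≤ ∫ x, Real.exp (-f x) ∂(Literature.Geometry.Lorentzian.riemannianMeasure (g.toContMDiffRiemannianMetric hg)) := by
  intro M _ _ _ _ _ _ _ _ _ g _ f hg hc hf hsol hnorm A hA
  have hR0 : ∀ x, 0 ≤ g.scalarCurvature x :=
    shrinkerScalarCurvature_nonneg_holds 4 M g f hg hc hf hsol hnorm
  have hf0 : ∀ x, 0 ≤ f x := fun x ↦ by
    have h1 := hnorm x
    have h2 := g.gradSq_nonneg hg f x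
    linarith [hR0 x]
  have hint : ∀ T : ℝ, 0 < T → Integrable (fun x ↦ Real.exp (-f x / T))
      (riemannianMeasure (g.toContMDiffRiemannianMetric hg)) :=
    fun T hT ↦ (stub_weightedIntegrability M g f hg hc hf hsol hnorm T hT).1
  have ha : Tendsto (fun T : ℝ ↦ (16 * Real.pi ^ 2 * T ^ 2)⁻¹ *
      ∫ x, Real.exp (-f x / T) ∂(riemannianMeasure (g.toContMDiffRiemannianMetric hg))) atTop (𝓝 A) :=
    helper_avr_eq_sublevelLimit M (riemannianMeasure (g.toContMDiffRiemannianMetric hg)) f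
      hf.continuous.measurable hf0 hint A hA
  exact helper_avr_le_density M g f hg hc hf hsol hnorm A ha

/-- **"Shrinker cones are thin"** in classical form (card `avr-window`; necessary condition / cheapest falsifier of
the crux): `ConicalGap` implies that every complete connected non-compact non-flat normalised 4-d gradient shrinker
with `R → 0` at infinity whose sublevel volume ratio `Vol{f < t}/(8π² t²)` converges to `A` has
`A ≤ 2√π e^{-3/2} = Θ(S³×ℝ) ≈ 0.791` (`helper_avr_eq_sublevelLimit` + `helper_thinCone_of_conicalGap`). -/
theorem helper_sublevelAvr_le_of_conicalGap : Summit.SmoothPoincare4.SmoothPoincare4.Theses.EntropyRung.ConicalGap → ∀ (M : Type) [TopologicalSpace M] [T2Space M] [SecondCountableTopology M] [ChartedSpace (EuclideanSpace ℝ (Fin 4)) M] [IsManifold (𝓡 4) ∞ M] [ConnectedSpace M] [NoncompactSpace M] [T3Space M] [MeasurableSpace M] [BorelSpace M] (g : Literature.Geometry.Lorentzian.PseudoRiemannianMetric (𝓡 4) ∞ (EuclideanSpace ℝ (Fin 4)) (TangentSpace (𝓡 4) : M → Type _)) [g.HasLeviCivita] (f : M → ℝ) (hg : g.IsRiemannian),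 (∀ (x : M) (r : NNReal), IsCompact {y : M | g.edist hg x y ≤ r}) → ContMDiff (𝓡 4) 𝓘(ℝ, ℝ) ∞ f → (∀ (x : M) (X Y : TangentSpace (𝓡 4) x), g.ricci x X Y + g.hessian f x X Y = (1 / 2 : ℝ) * g.val x X Y) → (∀ x : M, g.scalarCurvature x + g.gradSq f x = f x) → (∃ x : M, g.scalarCurvature x ≠ 0) → (∀ ε : ℝ, 0 < ε → ∃ K : Set M, IsCompact K ∧ ∀ x, x ∉ K → g.scalarCurvature x < ε) → ∀ A : ℝ, Filter.Tendsto (fun t : ℝ ↦ ((Literature.Geometry.Lorentzian.riemannianMeasure (g.toContMDiffRiemannianMetric hg)) {x | f x < t}).toReal / (8 * Real.pi ^ 2 * t ^ 2)) Filter.atTop (nhds A) → A ≤ 2 * Real.sqrt Real.pi * Real.exp (-(3 : ℝ) / 2) := by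
  intro hgap M _ _ _ _ _ _ _ _ _ _ g _ f hg hc hf hsol hnorm hnf hdec A hA
  have hR0 : ∀ x, 0 ≤ g.scalarCurvature x :=
    shrinkerScalarCurvature_nonneg_holds 4 M g f hg hc hf hsol hnorm
  have hf0 : ∀ x, 0 ≤ f x := fun x ↦ by
    have h1 := hnorm x
    have h2 := g.gradSq_nonneg hg f x
    linarith [hR0 x]
  have hint : ∀ T : ℝ, 0 < T → Integrable (fun x ↦ Real.exp (-f x / T))
      (riemannianMeasure (g.toContMDiffRiemannianMetric hg)) :=
    fun T hT ↦ (stub_weightedIntegrability M g f hg hc hf hsol hnorm T hT).1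
  have ha : Tendsto (fun T : ℝ ↦ (16 * Real.pi ^ 2 * T ^ 2)⁻¹ *
      ∫ x, Real.exp (-f x / T) ∂(riemannianMeasure (g.toContMDiffRiemannianMetric hg))) atTop (𝓝 A) :=
    helper_avr_eq_sublevelLimit M (riemannianMeasure (g.toContMDiffRiemannianMetric hg)) f
      hf.continuous.measurable hf0 hint A hA
  have h16 := helper_thinCone_of_conicalGap hgap M g f hg hc hf hsol hnorm hnf hdec A ha
  have hpi : 0 < 16 * Real.pi ^ 2 := by positivity
  have hkey : 16 * Real.pi ^ 2 * A ≤ 16 * Real.pi ^ 2 * (2 * Real.sqrt Real.pi * Real.exp (-(3 : ℝ) / 2)) := by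
    linarith
  exact le_of_mul_le_mul_left hkey hpi

end Summit.SmoothPoincare4.SmoothPoincare4.Theorems.ConicalGapSketch

end
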